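import Literature.NumberTheory.CubicFields.PureCubicLatticeSpecs
import Literature.NumberTheory.NumberFields.PureCubicOrder
import HarnessLib

/-!
# Codes of lattices of a pure cubic field: the canonical codes of the degree-one primes

Topic `NumberTheory/CubicFields`; theorem-only sequel of `PureCubicLatticeSpecs.lean` (the lattice
programs `latProd`, `latOfGens` on codes of lattices of `K = ℚ(θ)`, `θ³ = ab²`, in Dedekind's basis
`(1, θ, θ₂ = θ²/b)`) and of `NumberFields/PureCubicDegreeOnePrimes.lean` (Dedekind–Kummer above the
primes `p ∤ 3ab²`: the primes of norm `p` are exactly the ideals `(p, θ - r)`, `r < p`,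
`r³ ≡ ab² (mod p)`, distinct roots giving distinct ideals).

For a canonical code `c` of the maximal order `𝓞 K` (an input: `Mem θ b c = {integral elements}`),
a prime `p` and a residue `r`, the code

  `latProd ((a, b), (c, latOfGens 1 [(p, 0, 0), (-r, 1, 0), (0, 0, p)]))`

(the `ℤ`-span of the products `𝓞 K · L`, `L = ℤ p + ℤ (θ - r) + ℤ p θ₂`) is canonical and its member
set is (the image in `K` of) the ideal `p 𝓞 K + (θ - r) 𝓞 K` (`canon_latOfGens_prime`,
`mem_latOfGens_prime_iff`, **`primeCode_spec`**). Consequently (**`degreeOnePrimeCodes`**), for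
`ab` squarefree, `ab ≠ 1`, `K` cubic, `p ∤ 3ab` prime: for every root `r < p` of `X³ ≡ ab² (mod p)`
this code is the canonical code of a non-zero prime ideal of norm `p`; distinct roots give codes
with distinct member sets; and every prime ideal of norm `p` is coded this way. This is the list of
degree-one prime ideals used as generators by class-group algorithms (Cohen GTM 138, §6.5; Buchmann's
subexponential algorithm), in the exact code-level form consumed by the quantum class-group line of
`Summits/QuantumAdvantage`.

## References

* H. Cohen, *A Course in Computational Algebraic Number Theory*, GTM 138, Springer 1993, §4.7.1
  (HNF representation of ideals, products), §4.8.2 (Thm. 4.8.13, Dedekind–Kummer), §6.4.5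
  (pure cubic fields). [Cohen1993]
-/

noncomputable section

open scoped NumberField

namespace Literature.NumberTheory.CubicFields

namespace PureCubicCodes

open Literature.NumberTheory.NumberFields

variable {K : Type*} [Field K]

/-! ### The auxiliary lattice `L = ℤ p + ℤ (θ - r) + ℤ p θ₂` -/

/-- The code of `L = ℤ p + ℤ(θ - r) + ℤ pθ₂` is canonical for `p ≠ 0` (full rank: `p e₁`,
`p e₂ = p (θ - r) + r p`, `p e₃` lie in `L`). [cite: Cohen1993, §4.7.1] -/
theorem canon_latOfGens_prime {p : ℕ} (hp : p ≠ 0) (r : ℕ) :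
    Canon (latOfGens 1 [((p : ℤ), 0, 0), (-(r : ℤ), 1, 0), (0, 0, (p : ℤ))]) := by
  have hN : (p : ℤ) ≠ 0 := by exact_mod_cast hp
  refine canon_latOfGens le_rfl _ hN ?_ ?_ ?_ <;> rw [closure_list3, mem_rowSpan_iff]
  · exact ⟨1, 0, 0, by simp⟩
  · refine ⟨r, p, 0, Prod.ext ?_ (Prod.ext ?_ ?_)⟩ <;> dsimp only <;> ring
  · exact ⟨0, 0, 1, by simp⟩

/-- **Members of `L`**: `Mem θ b (code of L) φ ↔ φ = u p + v (θ - r) + w p θ₂` for integers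
`u, v, w`. [cite: Cohen1993, §4.7.1] -/
theorem mem_latOfGens_prime_iff [CharZero K] (θ : K) (b p r : ℕ) (φ : K) :
    Mem θ b (latOfGens 1 [((p : ℤ), 0, 0), (-(r : ℤ), 1, 0), (0, 0, (p : ℤ))]) φ ↔
      ∃ u v w : ℤ, φ = (u : K) * (p : K) + (v : K) * (θ - (r : K)) +
        (w : K) * ((p : K) * (θ ^ 2 / (b : K))) := by
  rw [mem_latOfGens_iff θ b le_rfl, closure_list3]
  constructor
  · rintro ⟨rr, hrr, e⟩
    obtain ⟨u, v, w, rfl⟩ := mem_rowSpan_iff.1 hrr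
    refine ⟨u, v, w, ?_⟩
    rw [Nat.cast_one, one_mul] at e
    rw [e]
    simp only [lin]
    push_cast
    ring
  · rintro ⟨u, v, w, rfl⟩
    refine ⟨_, mem_rowSpan_iff.2 ⟨u, v, w, rfl⟩, ?_⟩
    rw [Nat.cast_one, one_mul]
    simp only [lin]
    push_cast
    ring

/-! ### The code of `p 𝓞 K + (θ - r) 𝓞 K` -/

/-- **The code of the ideal `(p, θ - r)`.** For a canonical code `c` whose member set is the set of
algebraic integers of `K` (a code of `𝓞 K`), `θ₂ = θ²/b` integral and `p ≠ 0`, the code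
`latProd ((a, b), (c, code of L))` is canonical and its members are exactly the images in `K` of the
elements of the ideal `p 𝓞 K + (θ - r) 𝓞 K` (`𝓞 K · L = p 𝓞 K + (θ - r) 𝓞 K` since `p θ₂ ∈ p 𝓞 K`).
[cite: Cohen1993, §4.7.1] -/
theorem primeCode_spec [NumberField K] (θ : K) {a b : ℕ} (hb : (b : K) ≠ 0)
    (hθ : θ ^ 3 = ((a * b ^ 2 : ℕ) : K)) (hθ₂ : IsIntegral ℤ (θ ^ 2 / (b : K)))
    (θ' : 𝓞 K) (hθ' : (θ' : K) = θ) {c : ℕ × List ℤ} (hc : Canon c)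
    (hmem : ∀ φ : K, Mem θ b c φ ↔ IsIntegral ℤ φ) {p : ℕ} (hp : p ≠ 0) (r : ℕ) :
    Canon (latProd ((a, b), (c, latOfGens 1 [((p : ℤ), 0, 0), (-(r : ℤ), 1, 0), (0, 0, (p : ℤ))]))) ∧
    ∀ φ : K, Mem θ b (latProd ((a, b), (c, latOfGens 1 [((p : ℤ), 0, 0), (-(r : ℤ), 1, 0), (0, 0, (p : ℤ))]))) φ ↔
      ∃ ψ : 𝓞 K, ψ ∈ Ideal.span {(p : 𝓞 K), θ' - (r : 𝓞 K)} ∧ (ψ : K) = φ := by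
  obtain ⟨hcan, hmemP⟩ := latProd_spec θ hb hθ c _ hc (canon_latOfGens_prime hp r)
  refine ⟨hcan, fun φ => ?_⟩
  rw [hmemP φ]
  constructor
  · intro hφ
    induction hφ using AddSubgroup.closure_induction with
    | mem x hx =>
      obtain ⟨ψ₁, ψ₂, h₁, h₂, rfl⟩ := hx
      obtain ⟨u, v, w, rfl⟩ := (mem_latOfGens_prime_iff θ b p r ψ₂).1 h₂
      have hx : IsIntegral ℤ ψ₁ := (hmem ψ₁).1 h₁
      refine ⟨⟨ψ₁, hx⟩ * ((u : 𝓞 K) * (p : 𝓞 K) + (v : 𝓞 K) * (θ' - (r : 𝓞 K)) +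
          (w : 𝓞 K) * ((p : 𝓞 K) * ⟨θ ^ 2 / (b : K), hθ₂⟩)), ?_, ?_⟩
      · exact Ideal.mem_span_pair.2 ⟨⟨ψ₁, hx⟩ * ((u : 𝓞 K) + (w : 𝓞 K) * ⟨θ ^ 2 / (b : K), hθ₂⟩),
          ⟨ψ₁, hx⟩ * (v : 𝓞 K), by ring⟩
      · simp [← hθ']
    | zero => exact ⟨0, Ideal.zero_mem _, by simp⟩
    | add x y _ _ ihx ihy =>
      obtain ⟨ψ, hψ, rfl⟩ := ihx
      obtain ⟨ψ', hψ', rfl⟩ := ihy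
      exact ⟨ψ + ψ', Ideal.add_mem _ hψ hψ', by simp⟩
    | neg x _ ih =>
      obtain ⟨ψ, hψ, rfl⟩ := ih
      exact ⟨-ψ, neg_mem hψ, by simp⟩
  · rintro ⟨ψ, hψ, rfl⟩
    obtain ⟨x, y, rfl⟩ := Ideal.mem_span_pair.1 hψ
    have hpL : Mem θ b (latOfGens 1 [((p : ℤ), 0, 0), (-(r : ℤ), 1, 0), (0, 0, (p : ℤ))]) (p : K) :=
      (mem_latOfGens_prime_iff θ b p r _).2 ⟨1, 0, 0, by simp⟩
    have hθL : Mem θ b (latOfGens 1 [((p : ℤ), 0, 0), (-(r : ℤ), 1, 0), (0, 0, (p : ℤ))]) (θ - (r : K)) :=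
      (mem_latOfGens_prime_iff θ b p r _).2 ⟨0, 1, 0, by simp⟩
    have e : (((x * (p : 𝓞 K) + y * (θ' - (r : 𝓞 K))) : 𝓞 K) : K) =
        (x : K) * (p : K) + (y : K) * (θ - (r : K)) := by
      simp [← hθ']
    rw [e]
    exact AddSubgroup.add_mem _
      (AddSubgroup.subset_closure ⟨x, p, (hmem _).2 (NumberField.RingOfIntegers.isIntegral_coe x), hpL, rfl⟩)
      (AddSubgroup.subset_closure ⟨y, θ - r, (hmem _).2 (NumberField.RingOfIntegers.isIntegral_coe y), hθL, rfl⟩)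

/-! ### Dedekind–Kummer on codes: the degree-one primes above `p ∤ 3ab` -/

/-- A prime `p ∤ 3ab` does not divide `3ab²`. [folklore] -/
theorem not_dvd_three_mul_of_not_dvd {p a b : ℕ} (hp : p.Prime) (hpab : ¬ p ∣ 3 * (a * b)) :
    ¬ p ∣ 3 * (a * b ^ 2) := by
  intro h
  rcases (Nat.Prime.dvd_mul hp).1 h with h | h
  · exact hpab (dvd_mul_of_dvd_left h _)
  · rcases (Nat.Prime.dvd_mul hp).1 h with h | h
    · exact hpab (dvd_mul_of_dvd_right (dvd_mul_of_dvd_left h _) _)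
    · exact hpab (dvd_mul_of_dvd_right (dvd_mul_of_dvd_right (hp.dvd_of_dvd_pow h) _) _)

/-- **The degree-one primes of `ℚ(∛(ab²))` above `p ∤ 3ab` as canonical lattice codes** (Dedekind–Kummer
on codes). Let `ab` be squarefree, `ab ≠ 1`, `K` a cubic number field, `θ ∈ K`, `θ³ = ab²`, `c` a
canonical code of `𝓞 K` and `p ∤ 3ab` a prime; write `𝔠(r)` for the code
`latProd ((a, b), (c, latOfGens 1 [(p, 0, 0), (-r, 1, 0), (0, 0, p)]))` of `p 𝓞 K + (θ - r) 𝓞 K`. Then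
(i) for every root `r < p` of `X³ ≡ ab² (mod p)`, `𝔠(r)` is canonical and its member set is a non-zero
prime ideal of norm `p`; (ii) two such roots whose codes have the same member set are equal;
(iii) every prime ideal of norm `p` is the member set of some `𝔠(r)`, `r < p` a root.
[cite: Cohen1993, §4.8.2 Thm. 4.8.13 and §6.4.5] -/
theorem degreeOnePrimeCodes {a b : ℕ} (hab : Squarefree (a * b)) (hab1 : a * b ≠ 1)
    (K : Type*) [Field K] [NumberField K] (h3 : Module.finrank ℚ K = 3)
    (θ : K) (hθ : θ ^ 3 = ((a * b ^ 2 : ℕ) : K))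
    (c : ℕ × List ℤ) (hc : Canon c) (hmem : ∀ φ : K, Mem θ b c φ ↔ IsIntegral ℤ φ)
    (p : ℕ) (hp : p.Prime) (hpab : ¬ p ∣ 3 * (a * b)) :
    (∀ r : ℕ, r < p → r ^ 3 % p = (a * b ^ 2) % p →
      Canon (latProd ((a, b), (c, latOfGens 1 [((p : ℤ), 0, 0), (-(r : ℤ), 1, 0), (0, 0, (p : ℤ))]))) ∧
      ∃ (P : Ideal (𝓞 K)) (_ : P ∈ nonZeroDivisors (Ideal (𝓞 K))), P.IsPrime ∧ Ideal.absNorm P = p ∧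
        ∀ φ : K, Mem θ b (latProd ((a, b), (c, latOfGens 1
            [((p : ℤ), 0, 0), (-(r : ℤ), 1, 0), (0, 0, (p : ℤ))]))) φ ↔
          ∃ ψ : 𝓞 K, ψ ∈ P ∧ (ψ : K) = φ) ∧
    (∀ r r' : ℕ, r < p → r' < p → r ^ 3 % p = (a * b ^ 2) % p → r' ^ 3 % p = (a * b ^ 2) % p →
      (∀ φ : K, Mem θ b (latProd ((a, b), (c, latOfGens 1
            [((p : ℤ), 0, 0), (-(r : ℤ), 1, 0), (0, 0, (p : ℤ))]))) φ ↔
        Mem θ b (latProd ((a, b), (c, latOfGens 1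
            [((p : ℤ), 0, 0), (-(r' : ℤ), 1, 0), (0, 0, (p : ℤ))]))) φ) → r = r') ∧
    (∀ Q : Ideal (𝓞 K), Q.IsPrime → Ideal.absNorm Q = p →
      ∃ r : ℕ, r < p ∧ r ^ 3 % p = (a * b ^ 2) % p ∧
        ∀ φ : K, Mem θ b (latProd ((a, b), (c, latOfGens 1
            [((p : ℤ), 0, 0), (-(r : ℤ), 1, 0), (0, 0, (p : ℤ))]))) φ ↔
          ∃ ψ : 𝓞 K, ψ ∈ Q ∧ (ψ : K) = φ) := by
  have hbK : (b : K) ≠ 0 := Nat.cast_ne_zero.2 (PureCubic.ne_zero_of_squarefree_mul hab).2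
  have hm : ∀ r : ℕ, r ^ 3 ≠ a * b ^ 2 := PureCubic.not_cube hab hab1
  have hθ₂ : IsIntegral ℤ (θ ^ 2 / (b : K)) := PureCubic.isIntegral_theta₂ hab hθ
  obtain ⟨θ', hθ', hθ'3⟩ :=
    PureCubic.exists_ringOfIntegers_of_cube_eq (K := K) (m := a * b ^ 2) (α := θ) (by exact_mod_cast hθ)
  have hpm : ¬ p ∣ 3 * (a * b ^ 2) := not_dvd_three_mul_of_not_dvd hp hpab
  have key := fun r : ℕ => primeCode_spec θ hbK hθ hθ₂ θ' hθ' hc hmem hp.ne_zero r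
  have hroot : ∀ r : ℕ, r ^ 3 % p = (a * b ^ 2) % p →
      ((r : ℤ) : ZMod p) ^ 3 = ((a * b ^ 2 : ℕ) : ZMod p) := fun r h => by
    rw [Int.cast_natCast, ← Nat.cast_pow, ZMod.natCast_eq_natCast_iff']
    exact h
  have hprime : ∀ r : ℕ, r ^ 3 % p = (a * b ^ 2) % p →
      (Ideal.span {(p : 𝓞 K), θ' - (r : 𝓞 K)}).IsPrime ∧
        Ideal.absNorm (Ideal.span {(p : 𝓞 K), θ' - (r : 𝓞 K)}) = p := fun r h => by
    have h1 := PureCubic.isPrime_span_pair h3 hm hθ'3 hp hpm (hroot r h)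
    have h2 := PureCubic.absNorm_span_pair h3 hm hθ'3 hp hpm (hroot r h)
    rw [Int.cast_natCast] at h1 h2
    exact ⟨h1, h2⟩
  refine ⟨fun r _ hr3 => ⟨(key r).1, Ideal.span {(p : 𝓞 K), θ' - (r : 𝓞 K)}, ?_, (hprime r hr3).1,
    (hprime r hr3).2, (key r).2⟩, fun r r' hr hr' h3r h3r' hiff => ?_, fun Q hQ hQn => ?_⟩
  · rw [mem_nonZeroDivisors_iff_ne_zero]
    intro h0
    have h2 := (hprime r hr3).2
    rw [h0, Ideal.zero_eq_bot, Ideal.absNorm_bot] at h2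
    exact hp.ne_zero h2.symm
  · have e : Ideal.span {(p : 𝓞 K), θ' - (r : 𝓞 K)} = Ideal.span {(p : 𝓞 K), θ' - (r' : 𝓞 K)} := by
      ext ψ
      constructor
      · intro h
        obtain ⟨ψ', h', e⟩ := ((key r').2 ψ).1 ((hiff ψ).1 (((key r).2 ψ).2 ⟨ψ, h, rfl⟩))
        rwa [NumberField.RingOfIntegers.ext e] at h'
      · intro h
        obtain ⟨ψ', h', e⟩ := ((key r).2 ψ).1 ((hiff ψ).2 (((key r').2 ψ).2 ⟨ψ, h, rfl⟩))
        rwa [NumberField.RingOfIntegers.ext e] at h'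
    exact PureCubic.injOn_span_pair h3 hm hθ'3 hp hpm ⟨hr, h3r⟩ ⟨hr', h3r'⟩ e
  · obtain ⟨r, hr, hrm, rfl⟩ := PureCubic.exists_eq_span_pair h3 hm hθ'3 hp hpm hQ hQn
    exact ⟨r, hr, hrm, (key r).2⟩

end PureCubicCodes

end Literature.NumberTheory.CubicFields

end
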